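/-
Copyright (c) 2026 the pub-hodgecm-mathlib formalisation cell (harness21).  Prover seat hodgecm-mathlib-LH4-p10 (g3), req620 Track A «(D-RAM) FOUR-FRAME» squad
(dealer LH4-plan (g11) WORD #55 (3) «κ-GENERIC DECOMPOSITIONS»: the weight-generic, law-free MEASURE-SIDE split of the two Stage-B index sets into strata over the axis box,
for the κ-assemblers F0P3a-p01 (g32) (unsigned pair) and LH4-p14 (g3) (signed pair, κ-BOX-SUM)).  2026-09-04.
-/
import Summits.HodgeConjecture.HodgeConjecture.Theorems.F0P3cDyRamStableCountTypeTwoGeneric       -- ★ p856349 (LH4-p10 (g2)): `finsum_mem_eq_finsum_mem_sep_of_eq_zero`; brings ★ B10 p856280 `finite_normalisedStableLattices`, ★ PART 1 p855987, ★ StrataAxis, ★ B3-γ `hasAxis_shapes`, ★ StrataDefs ED. 3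
import Summits.HodgeConjecture.HodgeConjecture.Theorems.F0P3cDyRamDiagonalStrataShapesTypeTwo    -- ★ B3₂-γ p856358 (LH4-p04 (g2)): `hasAxis_shapes_typeTwo`
import HarnessLib

/-!
# Crux `H413`, (D-RAM) FOUR-FRAME, U3 §K-R support — THE WEIGHT-GENERIC STRATUM DECOMPOSITION OF THE TWO STAGE-B INDEX SETS (law-free)

Cell `hodgecm-mathlib` (D-0151), FLOOR 0, crux item H413 = `stmt-HodgeConjecture-24833`, route of record `HCCMUnconditional`; lane `--supports stmt-HodgeConjecture-24833 --as helper`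
(count-neutral).  THEOREMS ONLY (no `def`, no instance, no notation, no `sorry`); NO census law, NO table, NO arithmetic — pure measure-side bookkeeping.

WHY.  The four κ-Stage-B children of U3 ED. 10 (`stub_U3_kappaCount_typeZero`, `…_typeTwo_mult`, `stub_U3_kappaSignCount_typeZero`, `…_typeTwo_mult`) sum a SIGNED weight
`f M = kappaCount σ ϖ tv i M · stabiliserWeight σ M` over EXACTLY the two index sets `{M ∈ 𝓛₀(T) | IsDualisableLattice σ ϖ M}` (type 0) and `{M ∈ 𝓛₀(T) | IsTypeTwoPolarisable σ ϖ M}`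
(type 2).  The ★ stable-count assemblies (★ B10 `finsum_stabiliserWeight_dualisable_eq`, ★ B10₂ `finsum_mem_normalisedStableLattices_eq_of_typeTwo_table`) perform the measure-side
split INSIDE their proofs and then apply the STABLE table; the κ-assemblers need the split BY NAME, for an arbitrary weight, with no table attached.  This file states it once:
* §1 `stratum_eq_empty_of_not_shape` ∕ `finsum_mem_stratum_eq_zero_of_not_shape` (type 0, ★ B3-γ) and `stratumTwo_eq_empty_of_not_shape` ∕ `finsum_mem_stratumTwo_eq_zero_of_not_shape`
  (type 2, ★ B3₂-γ DISCHARGED — no `hshapes` binder): strata off the shape lists are EMPTY, so ANY weight (any `AddCommMonoid`) sums to `0` there — the `hzero` binder of the box-sum identities;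
* §2 `finite_dualisablePart`, `finite_typeTwoPolarisablePart`, `finite_stratum`, `finite_stratumTwo` — finiteness of the index sets and of every cell (for `finsum` algebra downstream);
* §3 HEADS `finsum_mem_dualisable_eq_sum_box_finsum_mem_stratum` (type 0) and `finsum_mem_typeTwoPolarisable_eq_sum_box_finsum_mem_stratumTwo` (type 2): for ANY weight `f : lattice → ℚ`
  and ANY box bound `B ≥ n₁ + n₂ + n₃`, `Σᶠ_{M ∈ part} f M = Σ_{a : Fin 3 → Fin (B+1)} Σᶠ_{M ∈ stratum(T, a)} f M` — the left-hand side is the children's index set VERBATIM, the right-hand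
  side is the box sum `Σ_{a} v (fun i => (a i : ℕ))` of ★ PART 2 ∕ κ-BOX-SUM at `v := fun a => Σᶠ_{M ∈ stratum(T, a)} f M` VERBATIM;
* §4 the same two heads from the WHOLE of `𝓛₀(T)` for a weight vanishing off the part (`…normalisedStableLattices_eq_sum_box_…`), by ★ `finsum_mem_eq_finsum_mem_sep_of_eq_zero`.
Assembler recipe (κ-B₀): `rw [finsum_mem_dualisable_eq_sum_box_finsum_mem_stratum hD hE T hT le_rfl f]`, then the box-sum identity at `v := fun a => ∑ᶠ M ∈ stratum σ ϖ T a, f M` with the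
κ-sockets as its `hcore ∕ hT· ∕ hG· ∕ hH` binders and `hzero := fun a ha => finsum_mem_stratum_eq_zero_of_not_shape hD T f a ha`; (κ-B₂) likewise with the `…Two` names.
HONEST LABEL.  Count-neutral; `HC_CM` is proved only modulo the 7 printed citations (2 remaining named inputs: hLiu418 = `stmt-HodgeConjecture-24832`, h413 = `stmt-HodgeConjecture-24833`) until rung 0 closes.

## References
* [Kottwitz1986BaseChangeUnits] R. Kottwitz, *Base change for unit elements of Hecke algebras*, Compositio Math. 60 (1986), §1 pp. 240–241 (counting fixed lattices by position).
* [Serre1980Trees] J.-P. Serre, *Trees*, Springer (1980), Ch. II §1.1 (apartments, axis exponents).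
-/

set_option autoImplicit false

noncomputable section

namespace Summit.HodgeConjecture.HodgeConjecture.Cruxes.H413.F0P3cDyRamStrataDecompositionGeneric

open Finset
open Literature.NumberTheory.Automorphic Literature.NumberTheory.Automorphic.HermitianLattice
open Literature.NumberTheory.Automorphic.UnitaryLatticeTree Literature.NumberTheory.Automorphic.UnitaryThreeFourFrame
open Summit.HodgeConjecture.HodgeConjecture.Cruxes.H413.F0P3cDyRamDiagonalTorusDefs
open Summit.HodgeConjecture.HodgeConjecture.Cruxes.H413.F0P3cDyRamDiagonalStrataDefs
open Summit.HodgeConjecture.HodgeConjecture.Cruxes.H413.F0P3cDyRamStrataPartition (finsum_mem_eq_sum_box_finsum_mem_hasAxis)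
open Summit.HodgeConjecture.HodgeConjecture.Cruxes.H413.F0P3cDyRamDiagonalStrataAxis (exists_hasAxis hasAxis_unique)
open Summit.HodgeConjecture.HodgeConjecture.Cruxes.H413.F0P3cDyRamDiagonalStrataShapes (hasAxis_shapes)
open Summit.HodgeConjecture.HodgeConjecture.Cruxes.H413.F0P3cDyRamDiagonalStrataShapesTypeTwo (hasAxis_shapes_typeTwo)
open Summit.HodgeConjecture.HodgeConjecture.Cruxes.H413.F0P3cDyRamStableCountTypeZero (finite_normalisedStableLattices)
open Summit.HodgeConjecture.HodgeConjecture.Cruxes.H413.F0P3cDyRamStableCountTypeTwoGeneric (finsum_mem_eq_finsum_mem_sep_of_eq_zero)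
open scoped Valued WithZero Matrix MatrixGroups

variable {K : Type} [Field K] [Valued K ℤᵐ⁰]

/-! ## §1  Strata off the shape lists are empty — any weight sums to zero there (the `hzero` binder of every box-sum identity) -/

/-- **TYPE 0 — A STRATUM OFF THE ★ B3-γ SHAPE LIST IS EMPTY** (core `0`, on-branch `(0,s,s)` `s` even `≥ 2`, glued `(2ρ, 2ρ+s, 2ρ+s)` `ρ ≥ 1`, `s` even `≥ 2`, core-hanging `(2ρ,2ρ,2ρ)`
`ρ ≥ 1`, and coordinate permutations — ★ `hasAxis_shapes`). [cite: Kottwitz1986BaseChangeUnits, §1 pp. 240–241] -/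
theorem stratum_eq_empty_of_not_shape {σ : K →+* K} {ϖ : K} {d t : ℕ} (hD : IsRamifiedQuadraticDatum σ ϖ d t) (T : GL (Fin 3) K) (a : Fin 3 → ℕ)
    (ha : ¬ ((a = ![0, 0, 0]) ∨
      (∃ s, 2 ∣ s ∧ 2 ≤ s ∧ (a = ![0, s, s] ∨ a = ![s, 0, s] ∨ a = ![s, s, 0])) ∨
      (∃ ρ s, 1 ≤ ρ ∧ 2 ∣ s ∧ 2 ≤ s ∧ (a = ![2 * ρ, 2 * ρ + s, 2 * ρ + s] ∨ a = ![2 * ρ + s, 2 * ρ, 2 * ρ + s] ∨ a = ![2 * ρ + s, 2 * ρ + s, 2 * ρ])) ∨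
      (∃ ρ, 1 ≤ ρ ∧ a = ![2 * ρ, 2 * ρ, 2 * ρ]))) :
    stratum σ ϖ T a = ∅ :=
  Set.eq_empty_of_forall_notMem fun M hM => by
    obtain ⟨hM₀, hdual, hax⟩ := (mem_stratum_iff σ ϖ T a M).1 hM
    exact ha (hasAxis_shapes hD hM₀ hdual hax)

/-- **TYPE 0 — ANY WEIGHT SUMS TO `0` OVER A STRATUM OFF THE SHAPE LIST** (the stratum is empty). [cite: Kottwitz1986BaseChangeUnits, §1 pp. 240–241] -/
theorem finsum_mem_stratum_eq_zero_of_not_shape {σ : K →+* K} {ϖ : K} {d t : ℕ} (hD : IsRamifiedQuadraticDatum σ ϖ d t) (T : GL (Fin 3) K)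
    {R : Type*} [AddCommMonoid R] (f : Submodule 𝒪[K] (Fin 3 → K) → R) (a : Fin 3 → ℕ)
    (ha : ¬ ((a = ![0, 0, 0]) ∨
      (∃ s, 2 ∣ s ∧ 2 ≤ s ∧ (a = ![0, s, s] ∨ a = ![s, 0, s] ∨ a = ![s, s, 0])) ∨
      (∃ ρ s, 1 ≤ ρ ∧ 2 ∣ s ∧ 2 ≤ s ∧ (a = ![2 * ρ, 2 * ρ + s, 2 * ρ + s] ∨ a = ![2 * ρ + s, 2 * ρ, 2 * ρ + s] ∨ a = ![2 * ρ + s, 2 * ρ + s, 2 * ρ])) ∨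
      (∃ ρ, 1 ≤ ρ ∧ a = ![2 * ρ, 2 * ρ, 2 * ρ]))) :
    ∑ᶠ M ∈ stratum σ ϖ T a, f M = 0 := by
  rw [stratum_eq_empty_of_not_shape hD T a ha, finsum_mem_empty]

/-- **TYPE 2 — A TYPE-2 STRATUM OFF THE ★ B3₂-γ SHAPE LIST IS EMPTY** (on-branch `(0,s,s)` `s` odd, glued `(2ρ+1, 2ρ+1+s, 2ρ+1+s)` `s` even `≥ 2`, core-hanging `(2ρ+1)³`, and coordinate
permutations — ★ `hasAxis_shapes_typeTwo`, DISCHARGED here: no `hshapes` binder). [cite: Kottwitz1986BaseChangeUnits, §1 pp. 240–241] -/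
theorem stratumTwo_eq_empty_of_not_shape {σ : K →+* K} {ϖ : K} {d t : ℕ} (hD : IsRamifiedQuadraticDatum σ ϖ d t) (T : GL (Fin 3) K) (a : Fin 3 → ℕ)
    (ha : ¬ ((∃ s, ¬ 2 ∣ s ∧ (a = ![0, s, s] ∨ a = ![s, 0, s] ∨ a = ![s, s, 0])) ∨
      (∃ ρ s, 2 ∣ s ∧ 2 ≤ s ∧ (a = ![2 * ρ + 1, 2 * ρ + 1 + s, 2 * ρ + 1 + s] ∨ a = ![2 * ρ + 1 + s, 2 * ρ + 1, 2 * ρ + 1 + s] ∨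
        a = ![2 * ρ + 1 + s, 2 * ρ + 1 + s, 2 * ρ + 1])) ∨
      (∃ ρ, a = ![2 * ρ + 1, 2 * ρ + 1, 2 * ρ + 1]))) :
    stratumTwo σ ϖ T a = ∅ :=
  Set.eq_empty_of_forall_notMem fun M hM => by
    obtain ⟨hM₀, hpol, hax⟩ := (mem_stratumTwo_iff σ ϖ T a M).1 hM
    exact ha (hasAxis_shapes_typeTwo hD hM₀ hpol hax)

/-- **TYPE 2 — ANY WEIGHT SUMS TO `0` OVER A TYPE-2 STRATUM OFF THE SHAPE LIST** (the stratum is empty; shape list discharged by ★ B3₂-γ). [cite: Kottwitz1986BaseChangeUnits, §1 pp. 240–241] -/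
theorem finsum_mem_stratumTwo_eq_zero_of_not_shape {σ : K →+* K} {ϖ : K} {d t : ℕ} (hD : IsRamifiedQuadraticDatum σ ϖ d t) (T : GL (Fin 3) K)
    {R : Type*} [AddCommMonoid R] (f : Submodule 𝒪[K] (Fin 3 → K) → R) (a : Fin 3 → ℕ)
    (ha : ¬ ((∃ s, ¬ 2 ∣ s ∧ (a = ![0, s, s] ∨ a = ![s, 0, s] ∨ a = ![s, s, 0])) ∨
      (∃ ρ s, 2 ∣ s ∧ 2 ≤ s ∧ (a = ![2 * ρ + 1, 2 * ρ + 1 + s, 2 * ρ + 1 + s] ∨ a = ![2 * ρ + 1 + s, 2 * ρ + 1, 2 * ρ + 1 + s] ∨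
        a = ![2 * ρ + 1 + s, 2 * ρ + 1 + s, 2 * ρ + 1])) ∨
      (∃ ρ, a = ![2 * ρ + 1, 2 * ρ + 1, 2 * ρ + 1]))) :
    ∑ᶠ M ∈ stratumTwo σ ϖ T a, f M = 0 := by
  rw [stratumTwo_eq_empty_of_not_shape hD T a ha, finsum_mem_empty]

/-! ## §2  Finiteness of the two index sets and of every cell -/

/-- The dualisable part of `𝓛₀(T)` (the index set of (κ-B₀) ∕ (κS-B₀) ∕ ★ B10) is finite. [cite: Kottwitz1986BaseChangeUnits, §1 pp. 240–241] -/
theorem finite_dualisablePart [Finite 𝓀[K]] {σ : K →+* K} {ϖ : K} {d t : ℕ} (hD : IsRamifiedQuadraticDatum σ ϖ d t)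
    {α β : K} {N₀ n₁ n₂ n₃ : ℕ} (hE : IsElementDatum σ ϖ N₀ α β n₁ n₂ n₃)
    (T : GL (Fin 3) K) (hT : (T : Matrix (Fin 3) (Fin 3) K) = Matrix.diagonal ![α, β, 1]) :
    ({M : Submodule 𝒪[K] (Fin 3 → K) | M ∈ normalisedStableLattices T ∧ IsDualisableLattice σ ϖ M}).Finite :=
  (finite_normalisedStableLattices hD hE T hT).subset fun _ hM => hM.1

/-- The type-2-polarisable part of `𝓛₀(T)` (the index set of (κ-B₂) ∕ (κS-B₂) ∕ ★ B10₂) is finite. [cite: Kottwitz1986BaseChangeUnits, §1 pp. 240–241] -/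
theorem finite_typeTwoPolarisablePart [Finite 𝓀[K]] {σ : K →+* K} {ϖ : K} {d t : ℕ} (hD : IsRamifiedQuadraticDatum σ ϖ d t)
    {α β : K} {N₀ n₁ n₂ n₃ : ℕ} (hE : IsElementDatum σ ϖ N₀ α β n₁ n₂ n₃)
    (T : GL (Fin 3) K) (hT : (T : Matrix (Fin 3) (Fin 3) K) = Matrix.diagonal ![α, β, 1]) :
    ({M : Submodule 𝒪[K] (Fin 3 → K) | M ∈ normalisedStableLattices T ∧ IsTypeTwoPolarisable σ ϖ M}).Finite :=
  (finite_normalisedStableLattices hD hE T hT).subset fun _ hM => hM.1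

/-- Every type-0 stratum `stratum σ ϖ T a` is finite. [cite: Kottwitz1986BaseChangeUnits, §1 pp. 240–241] -/
theorem finite_stratum [Finite 𝓀[K]] {σ : K →+* K} {ϖ : K} {d t : ℕ} (hD : IsRamifiedQuadraticDatum σ ϖ d t)
    {α β : K} {N₀ n₁ n₂ n₃ : ℕ} (hE : IsElementDatum σ ϖ N₀ α β n₁ n₂ n₃)
    (T : GL (Fin 3) K) (hT : (T : Matrix (Fin 3) (Fin 3) K) = Matrix.diagonal ![α, β, 1]) (a : Fin 3 → ℕ) :
    (stratum σ ϖ T a).Finite :=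
  (finite_normalisedStableLattices hD hE T hT).subset fun _ hM => hM.1

/-- Every type-2 stratum `stratumTwo σ ϖ T a` is finite. [cite: Kottwitz1986BaseChangeUnits, §1 pp. 240–241] -/
theorem finite_stratumTwo [Finite 𝓀[K]] {σ : K →+* K} {ϖ : K} {d t : ℕ} (hD : IsRamifiedQuadraticDatum σ ϖ d t)
    {α β : K} {N₀ n₁ n₂ n₃ : ℕ} (hE : IsElementDatum σ ϖ N₀ α β n₁ n₂ n₃)
    (T : GL (Fin 3) K) (hT : (T : Matrix (Fin 3) (Fin 3) K) = Matrix.diagonal ![α, β, 1]) (a : Fin 3 → ℕ) :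
    (stratumTwo σ ϖ T a).Finite :=
  (finite_normalisedStableLattices hD hE T hT).subset fun _ hM => hM.1

/-! ## §3  HEADS — the weight-generic split of the two index sets into strata over the axis box `[0, B]³`, `B ≥ n₁ + n₂ + n₃` -/

/-- **TYPE 0 · THE DUALISABLE PART OF `𝓛₀(T)` SPLIT INTO STRATA OVER THE AXIS BOX, FOR ANY WEIGHT.**  At a ramified quadratic datum and an element datum `(α, β; n₁, n₂, n₃)` (any
threshold `N₀`), `T = diag(α, β, 1)`, any `B ≥ n₁ + n₂ + n₃` and any `f : lattice → ℚ`: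
`Σᶠ_{M ∈ 𝓛₀(T), M dualisable} f M = Σ_{a : Fin 3 → Fin (B+1)} Σᶠ_{M ∈ stratum σ ϖ T a} f M`.
Proof: the set is finite (★ B10 `finite_normalisedStableLattices`), every member has a unique axis vector in the box (★ B3-α `exists_hasAxis`, ★ `hasAxis_unique`), ★ PART 1
`finsum_mem_eq_sum_box_finsum_mem_hasAxis`, and each cell is a stratum (★ `mem_stratum_iff`).  No law, no table. [cite: Kottwitz1986BaseChangeUnits, §1 pp. 240–241] [cite: Serre1980Trees, Ch. II §1.1] -/
theorem finsum_mem_dualisable_eq_sum_box_finsum_mem_stratum [Finite 𝓀[K]] {σ : K →+* K} {ϖ : K} {d t : ℕ} (hD : IsRamifiedQuadraticDatum σ ϖ d t)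
    {α β : K} {N₀ n₁ n₂ n₃ : ℕ} (hE : IsElementDatum σ ϖ N₀ α β n₁ n₂ n₃)
    (T : GL (Fin 3) K) (hT : (T : Matrix (Fin 3) (Fin 3) K) = Matrix.diagonal ![α, β, 1]) {B : ℕ} (hB : n₁ + n₂ + n₃ ≤ B)
    (f : Submodule 𝒪[K] (Fin 3 → K) → ℚ) :
    ∑ᶠ M ∈ {M : Submodule 𝒪[K] (Fin 3 → K) | M ∈ normalisedStableLattices T ∧ IsDualisableLattice σ ϖ M}, f M =
      ∑ a : Fin 3 → Fin (B + 1), ∑ᶠ M ∈ stratum σ ϖ T (fun i => (a i : ℕ)), f M := by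
  have hϖ : Valued.v ϖ = WithZero.exp (-1 : ℤ) := hD.2.2.1
  set S : Set (Submodule 𝒪[K] (Fin 3 → K)) := {M | M ∈ normalisedStableLattices T ∧ IsDualisableLattice σ ϖ M} with hS_def
  have hS : S.Finite := (finite_normalisedStableLattices hD hE T hT).subset fun M hM => hM.1
  have huniq : ∀ (M : Submodule 𝒪[K] (Fin 3 → K)) (a a' : Fin 3 → ℕ), HasAxis ϖ M a → HasAxis ϖ M a' → a = a' :=
    fun M a a' ha ha' => hasAxis_unique hϖ ha ha'
  have haxis : ∀ M ∈ S, ∃ a : Fin 3 → ℕ, HasAxis ϖ M a ∧ ∀ i, a i ≤ B := fun M hM => by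
    obtain ⟨a, ha, hle⟩ := exists_hasAxis hD hE hT hM.1
    exact ⟨a, ha, fun i => (hle i).trans hB⟩
  rw [finsum_mem_eq_sum_box_finsum_mem_hasAxis huniq S hS B haxis]
  have hcell : ∀ a : Fin 3 → ℕ, {M | M ∈ S ∧ HasAxis ϖ M a} = stratum σ ϖ T a := fun a => by
    ext M
    rw [mem_stratum_iff, Set.mem_setOf_eq, hS_def, Set.mem_setOf_eq, and_assoc]
  simp_rw [hcell]

/-- **TYPE 2 · THE TYPE-2-POLARISABLE PART OF `𝓛₀(T)` SPLIT INTO TYPE-2 STRATA OVER THE AXIS BOX, FOR ANY WEIGHT.**  Same data, any `B ≥ n₁ + n₂ + n₃`, any `f : lattice → ℚ`: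
`Σᶠ_{M ∈ 𝓛₀(T), M type-2-polarisable} f M = Σ_{a : Fin 3 → Fin (B+1)} Σᶠ_{M ∈ stratumTwo σ ϖ T a} f M` (★ `finite_normalisedStableLattices`, ★ `exists_hasAxis`, ★ `hasAxis_unique`,
★ PART 1, ★ `mem_stratumTwo_iff`).  No law, no table. [cite: Kottwitz1986BaseChangeUnits, §1 pp. 240–241] [cite: Serre1980Trees, Ch. II §1.1] -/
theorem finsum_mem_typeTwoPolarisable_eq_sum_box_finsum_mem_stratumTwo [Finite 𝓀[K]] {σ : K →+* K} {ϖ : K} {d t : ℕ} (hD : IsRamifiedQuadraticDatum σ ϖ d t)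
    {α β : K} {N₀ n₁ n₂ n₃ : ℕ} (hE : IsElementDatum σ ϖ N₀ α β n₁ n₂ n₃)
    (T : GL (Fin 3) K) (hT : (T : Matrix (Fin 3) (Fin 3) K) = Matrix.diagonal ![α, β, 1]) {B : ℕ} (hB : n₁ + n₂ + n₃ ≤ B)
    (f : Submodule 𝒪[K] (Fin 3 → K) → ℚ) :
    ∑ᶠ M ∈ {M : Submodule 𝒪[K] (Fin 3 → K) | M ∈ normalisedStableLattices T ∧ IsTypeTwoPolarisable σ ϖ M}, f M =
      ∑ a : Fin 3 → Fin (B + 1), ∑ᶠ M ∈ stratumTwo σ ϖ T (fun i => (a i : ℕ)), f M := by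
  have hϖ : Valued.v ϖ = WithZero.exp (-1 : ℤ) := hD.2.2.1
  set S : Set (Submodule 𝒪[K] (Fin 3 → K)) := {M | M ∈ normalisedStableLattices T ∧ IsTypeTwoPolarisable σ ϖ M} with hS_def
  have hS : S.Finite := (finite_normalisedStableLattices hD hE T hT).subset fun M hM => hM.1
  have huniq : ∀ (M : Submodule 𝒪[K] (Fin 3 → K)) (a a' : Fin 3 → ℕ), HasAxis ϖ M a → HasAxis ϖ M a' → a = a' :=
    fun M a a' ha ha' => hasAxis_unique hϖ ha ha'
  have haxis : ∀ M ∈ S, ∃ a : Fin 3 → ℕ, HasAxis ϖ M a ∧ ∀ i, a i ≤ B := fun M hM => by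
    obtain ⟨a, ha, hle⟩ := exists_hasAxis hD hE hT hM.1
    exact ⟨a, ha, fun i => (hle i).trans hB⟩
  rw [finsum_mem_eq_sum_box_finsum_mem_hasAxis huniq S hS B haxis]
  have hcell : ∀ a : Fin 3 → ℕ, {M | M ∈ S ∧ HasAxis ϖ M a} = stratumTwo σ ϖ T a := fun a => by
    ext M
    rw [mem_stratumTwo_iff, Set.mem_setOf_eq, hS_def, Set.mem_setOf_eq, and_assoc]
  simp_rw [hcell]

/-! ## §4  The same split from the whole of `𝓛₀(T)`, for a weight vanishing off the part -/

/-- **TYPE 0, FROM `𝓛₀(T)`**: a weight vanishing at the non-dualisable members of `𝓛₀(T)` splits over the type-0 strata of the box (★ `finsum_mem_eq_finsum_mem_sep_of_eq_zero` + §3).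
[cite: Kottwitz1986BaseChangeUnits, §1 pp. 240–241] -/
theorem finsum_mem_normalisedStableLattices_eq_sum_box_finsum_mem_stratum [Finite 𝓀[K]] {σ : K →+* K} {ϖ : K} {d t : ℕ} (hD : IsRamifiedQuadraticDatum σ ϖ d t)
    {α β : K} {N₀ n₁ n₂ n₃ : ℕ} (hE : IsElementDatum σ ϖ N₀ α β n₁ n₂ n₃)
    (T : GL (Fin 3) K) (hT : (T : Matrix (Fin 3) (Fin 3) K) = Matrix.diagonal ![α, β, 1]) {B : ℕ} (hB : n₁ + n₂ + n₃ ≤ B)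
    (f : Submodule 𝒪[K] (Fin 3 → K) → ℚ) (hf0 : ∀ M ∈ normalisedStableLattices T, ¬ IsDualisableLattice σ ϖ M → f M = 0) :
    ∑ᶠ M ∈ normalisedStableLattices T, f M = ∑ a : Fin 3 → Fin (B + 1), ∑ᶠ M ∈ stratum σ ϖ T (fun i => (a i : ℕ)), f M := by
  rw [finsum_mem_eq_finsum_mem_sep_of_eq_zero (normalisedStableLattices T) (IsDualisableLattice σ ϖ) f hf0]
  exact finsum_mem_dualisable_eq_sum_box_finsum_mem_stratum hD hE T hT hB f

/-- **TYPE 2, FROM `𝓛₀(T)`**: a weight vanishing at the non-type-2-polarisable members of `𝓛₀(T)` splits over the type-2 strata of the box (★ `finsum_mem_eq_finsum_mem_sep_of_eq_zero` + §3).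
[cite: Kottwitz1986BaseChangeUnits, §1 pp. 240–241] -/
theorem finsum_mem_normalisedStableLattices_eq_sum_box_finsum_mem_stratumTwo [Finite 𝓀[K]] {σ : K →+* K} {ϖ : K} {d t : ℕ} (hD : IsRamifiedQuadraticDatum σ ϖ d t)
    {α β : K} {N₀ n₁ n₂ n₃ : ℕ} (hE : IsElementDatum σ ϖ N₀ α β n₁ n₂ n₃)
    (T : GL (Fin 3) K) (hT : (T : Matrix (Fin 3) (Fin 3) K) = Matrix.diagonal ![α, β, 1]) {B : ℕ} (hB : n₁ + n₂ + n₃ ≤ B)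
    (f : Submodule 𝒪[K] (Fin 3 → K) → ℚ) (hf0 : ∀ M ∈ normalisedStableLattices T, ¬ IsTypeTwoPolarisable σ ϖ M → f M = 0) :
    ∑ᶠ M ∈ normalisedStableLattices T, f M = ∑ a : Fin 3 → Fin (B + 1), ∑ᶠ M ∈ stratumTwo σ ϖ T (fun i => (a i : ℕ)), f M := by
  rw [finsum_mem_eq_finsum_mem_sep_of_eq_zero (normalisedStableLattices T) (IsTypeTwoPolarisable σ ϖ) f hf0]
  exact finsum_mem_typeTwoPolarisable_eq_sum_box_finsum_mem_stratumTwo hD hE T hT hB f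

end Summit.HodgeConjecture.HodgeConjecture.Cruxes.H413.F0P3cDyRamStrataDecompositionGeneric

end
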